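import Literature.Geometry.Kaehler.ComplexTorusPicardNumberGapsGeneral
import Literature.Geometry.Kaehler.ComplexTorusEndomorphismSubfields
import Literature.Geometry.Kaehler.ComplexTorusAlbertClassificationLowDimension
import Literature.Geometry.Kaehler.ComplexTorusPicardNumberAlbertTypes
import Mathlib.LinearAlgebra.Dual.Lemmas
import HarnessLib

/-!
# Hulek–Laface 2019, Cor. 2.5 (Murty's bound) unconditionally: `ρ(A) ≤ 3/2 · dim A` and
# `ρ(Aᵏ) ≤ ½ n k (2k+1)` for every simple abelian variety, without Albert's classification

Layer `Literature/Geometry/Kaehler`, namespace `Literature.Geometry.Kaehler.ComplexTorus`; lane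
`lit-hodgefound` (Track 2 foundations library), seat `lit-hodgefound-p18`, generation 10, row g10-#2
(self-proposed; successor of p18's `ComplexTorusPicardNumberGapsGeneral` «TODO(general form): Murty 1984
Lemma 3.3 / Cor. 2.5 with the Albert-type constants» and of p12's `ComplexTorusPicardNumberAlbertTypes` §4,
which proves Cor. 2.5 TYPE BY TYPE under the hypotheses `IsAlbertTypeI … IV` — Albert's classification
theorem itself is not in the tree).  THEOREMS ONLY (no definition, no named fact; D-0026, net debt 0).

## The print

K. Hulek, R. Laface, *On the Picard numbers of abelian varieties*, Ann. Sc. Norm. Super. Pisa Cl. Sci. (5)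
XIX (2019) 1199–1224 [HulekLaface2019PicardNumbersAV] (held text `paper:arxiv-1703.05882`, p. 6 L26–L27),
VERBATIM: «**Corollary 2.5.** Let `A` be a simple abelian variety of dimension `n`, and let `k ≥ 1`. Then
`ρ(Aᵏ) ≤ ½ nk(2k+1)`.»  Printed proof (p. 6 L29–L74): Prop. 2.4 (= V. K. Murty, *Exceptional Hodge classes
on certain abelian varieties*, Math. Ann. 268 (1984), Lemma 3.3: `ρ(Aᵏ)` by Albert type) at `k = 1` gives
`ρ = e, 3e, e, ½ed²`; «The divisibility conditions for `ρ` given by [BL04] imply that `ρ ≤ n` (Type I),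
`3n/2` (Type II), `n/2` (Type III), `n` (Type IV)», whence `ρ(Aᵏ) ≤ ½nk(k+1)`, `½nk(2k+1)`, `½nk(2k−1)`,
`nk²`, «from which the result follows».

## What is proved, and how (recorded deviation: an Albert-free proof)

The printed proof runs through Albert's classification of the pairs `(End_ℚ(A), ′)` (Lange 2023, Thm.
2.6.5 / 2.6.8, Prop. 5.5.7), which the tree does not have.  The statement is proved here UNCONDITIONALLY by
an elementary count in the rational representation `End_ℚ(X) = endAlgRat Ψ ⊆ M_ι(ℚ)`, `|ι| = 2n`:
with `F = End_ℚ(X)` (a skew field for `X` simple, Cor. 2.4.26), `f = dim_ℚ F ∣ 2n` (Shimura 1963 §5.1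
Prop. 2, the tree's `IsSimple.finrank_endAlgRat_dvd_card`) and `ρ(X) = dim_ℚ End^s_ℚ(X)` (Prop. 2.4.12,
the tree's `finrank_hodgeClasses_one_eq_finrank_symmEndRat`):

* if `f < 2n` then `f ≤ n` and `ρ ≤ f ≤ n`;
* if `f = 2n` (`Λ_ℚ ≅ F`, the rank-one model of `ComplexTorusAlbertTypeIIIShimura` /
  `ComplexTorusDefiniteQuaternionMultiplicationSquare`), the polarisation `ᵗx G y = Tr(ξ A†B)` produces a
  non-zero `†`-skew `ξ ∈ F` (§1, `exists_skew_ne_zero_of_finrank_eq_card`), and then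
  **`4 · dim F^s ≤ 3 · dim F`** (§2, `four_mul_finrank_symm_le`): if `ξ` is central, `x ↦ ξx` embeds `F^s`
  in `F^-`; if not, `ξF^s ∩ F^s = ξ · {t ∈ F^s | tξ = −ξt}` embeds by `t ↦ t s₀⁻¹` into the centraliser
  `C_F(ξ)`, a PROPER division subalgebra of `F ⊆ M_ι(ℚ)`, whose dimension divides `|ι| = f` (Shimura's
  Prop. 2 again, the tree's `finrank_dvd_card_of_isUnit_or_eq_zero`), so `dim F^s ≤ dim F^- + f/2`;

hence **`2ρ(X) ≤ 3 dim X`** for every simple polarised torus (§3,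
`IsSimple.two_mul_finrank_neronSeveriGroup_le_three_mul`, Cor. 2.5 at `k = 1`), and with p18's type-free
Prop. 2.4 `ρ(Xᵏ) = kρ(X) + C(k,2)·f` (`IsAbelianVariety.finrank_neronSeveriGroup_pow`) and `f ≤ 2n`,
**`2ρ(Xᵏ) ≤ nk(2k+1)`** (`IsSimple.two_mul_finrank_neronSeveriGroup_pow_le`) — Cor. 2.5 as printed (§4:
the printed shapes `ρ ≤ 3n/2`, `ρ(Xᵏ) ≤ nk(2k+1)/2` with natural-number division, and along an isogeny
`A ∼ Bᵏ`, `IsIsogenous.two_mul_finrank_neronSeveriGroup_le_of_powPeriod`; §5: the printed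
divisibility conditions of Hulek–Laface §5.1 «(I) Type I: `ρ ∣ g`; (II) Type II: `ρ ∈ 3ℕ` and `⅔ρ ∣ g`;
(III) Type III: `2ρ ∣ g`; (IV) Type IV: `ρ ∣ g`» type by type under p12's `IsAlbertTypeI … IV`
hypotheses, and their disjunction unconditionally for `g ≤ 7` through p12's
`IsSimple.isAlbertType_of_finrank_le_seven`).  This
sharpens the substitute bound `ρ(Aᵏ) ≤ k·min(2n, n²−1) + k(k−1)n` of `ComplexTorusPicardNumberGapsGeneral`
(`IsSimple.finrank_neronSeveriGroup_pow_le`) by the printed `½nk`, and closes that file's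
`TODO(general form)`.

Scope, as numbers: "simple abelian variety of dimension `n`" = a complex torus `X = E/Ψ(ℤ^ι)` with
`IsSimple Ψ` carrying a Riemann form (`IsRiemannForm Ψ η`, resp. `IsAbelianVariety Ψ`), `n = dim_ℂ E ≥ 1`
(`[Nonempty ι]`); `ρ = finrank ℤ (neronSeveriGroup Ψ)`; `Aᵏ = powPeriod Ψ k`, every `k : ℕ`.

## References

* [HulekLaface2019PicardNumbersAV] K. Hulek, R. Laface, *On the Picard numbers of abelian varieties*
  (2019), §2 Prop. 2.4, Cor. 2.5 and its proof (arXiv:1703.05882, p. 6); §3.2 (b); §5.1 conditions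
  (I)–(IV) (p. 10).
* [Murty1984] V. K. Murty, *Exceptional Hodge classes on certain abelian varieties*, Math. Ann. 268
  (1984) 197–206, Lemma 3.3.
* [Lange2023AbelianVarietiesComplex] H. Lange, *Abelian Varieties over the Complex Numbers* (2023), §2.4.1
  Thm. 2.4.9 (positivity of the Rosati involution), §2.4.2 Prop. 2.4.12 (`NS_ℚ(X) ≅ End^s_ℚ(X)`), §2.4.4
  Cor. 2.4.26, §2.6.1 table (column `ρ`, restrictions).
* [Shimura1998] G. Shimura, *Abelian Varieties with Complex Multiplication and Modular Functions* (1998),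
  §5.1 Prop. 2 (`[ℜ : ℚ]` divides `2n` for a division subalgebra `ℜ ⊆ End_ℚ(A)`; here for subalgebras of
  `M_{2n}(ℚ)` acting on `ℚ^{2n}`).
-/

noncomputable section

open Module Matrix

namespace Literature.Geometry.Kaehler

namespace ComplexTorus

/-! ## §0 Matrix-algebra helpers -/

section MatrixAlgebra

variable {ι : Type*} [Fintype ι] [DecidableEq ι] {K : Type*} [Field K]

/-- A subalgebra of a matrix algebra over a field contains the inverses of its invertible elements.
[folklore] -/
private theorem nonsing_inv_mem_subalgebra' (S : Subalgebra K (Matrix ι ι K)) {A : Matrix ι ι K}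
    (hA : A ∈ S) (hu : IsUnit A.det) : A⁻¹ ∈ S := by
  let f : S →ₗ[K] S := LinearMap.mulLeft K (⟨A, hA⟩ : S)
  have hf : Function.Injective f := by
    intro s t hst
    have h1 : A * (s : Matrix ι ι K) = A * (t : Matrix ι ι K) := congrArg Subtype.val hst
    have h2 : A⁻¹ * (A * (s : Matrix ι ι K)) = A⁻¹ * (A * (t : Matrix ι ι K)) := by rw [h1]
    rwa [← Matrix.mul_assoc, ← Matrix.mul_assoc, Matrix.nonsing_inv_mul _ hu, Matrix.one_mul,
      Matrix.one_mul, Subtype.coe_inj] at h2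
  obtain ⟨s, hs⟩ := (LinearMap.injective_iff_surjective.1 hf) 1
  have hs' : A * (s : Matrix ι ι K) = 1 := congrArg Subtype.val hs
  have hinv : A⁻¹ = s := by
    rw [← Matrix.mul_one A⁻¹, ← hs', ← Matrix.mul_assoc, Matrix.nonsing_inv_mul _ hu, Matrix.one_mul]
  rw [hinv]
  exact s.2

/-- `ξ s⁻¹ = -s⁻¹ ξ` from `s ξ = -ξ s` (`s` invertible). [folklore] -/
private theorem mul_nonsing_inv_eq_neg_of_anticommute' {ξ s : Matrix ι ι K} (hsu : IsUnit s.det)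
    (h : s * ξ = -(ξ * s)) : ξ * s⁻¹ = -(s⁻¹ * ξ) := by
  have h1 : s⁻¹ * (s * ξ) * s⁻¹ = s⁻¹ * (-(ξ * s)) * s⁻¹ := by rw [h]
  rwa [← Matrix.mul_assoc, Matrix.nonsing_inv_mul _ hsu, Matrix.one_mul, Matrix.mul_neg, Matrix.neg_mul,
    Matrix.mul_assoc, Matrix.mul_assoc, Matrix.mul_nonsing_inv _ hsu, Matrix.mul_one] at h1

/-- `ξ a⁻¹ = a⁻¹ ξ` from `ξ a = a ξ` (`a` invertible). [folklore] -/
private theorem nonsing_inv_comm_of_comm' {ξ a : Matrix ι ι K} (hau : IsUnit a.det)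
    (h : ξ * a = a * ξ) : ξ * a⁻¹ = a⁻¹ * ξ := by
  have h1 : a⁻¹ * (ξ * a) * a⁻¹ = a⁻¹ * (a * ξ) * a⁻¹ := by rw [h]
  rw [← Matrix.mul_assoc a⁻¹ a ξ, Matrix.nonsing_inv_mul _ hau, Matrix.one_mul,
    Matrix.mul_assoc a⁻¹ (ξ * a) a⁻¹, Matrix.mul_assoc ξ a a⁻¹, Matrix.mul_nonsing_inv _ hau,
    Matrix.mul_one] at h1
  exact h1.symm

end MatrixAlgebra

/-! ## §1 The rank-one model, steps (a)–(d) only: a non-zero `†`-skew element of `F` -/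

section RankOne

variable {ι : Type*} [Fintype ι] [DecidableEq ι]

/-- `Λ_ℚ ≅ F` for a skew field `F ⊆ M_ι(ℚ)` with `dim_ℚ F = |ι|` (orbit map of a non-zero vector).
[folklore] -/
private theorem exists_linearEquiv_mulVec₃ (F : Subalgebra ℚ (Matrix ι ι ℚ))
    (hdiv : ∀ A ∈ F, A ≠ 0 → IsUnit A) (hdim : finrank ℚ F = Fintype.card ι) {v : ι → ℚ}
    (hv : v ≠ 0) : ∃ θ : F ≃ₗ[ℚ] (ι → ℚ), ∀ A : F, θ A = (A : Matrix ι ι ℚ) *ᵥ v := by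
  let f : F →ₗ[ℚ] (ι → ℚ) :=
    { toFun := fun A ↦ (A : Matrix ι ι ℚ) *ᵥ v
      map_add' := fun A B ↦ by simp only [Subalgebra.coe_add, Matrix.add_mulVec]
      map_smul' := fun c A ↦ by simp only [Subalgebra.coe_smul, Matrix.smul_mulVec, RingHom.id_apply] }
  have hf : Function.Injective f := by
    intro A B hAB
    by_contra hne
    have hne' : (A : Matrix ι ι ℚ) - (B : Matrix ι ι ℚ) ≠ 0 :=
      fun h ↦ hne (Subtype.ext (sub_eq_zero.1 h))
    have hu : IsUnit ((A : Matrix ι ι ℚ) - (B : Matrix ι ι ℚ)) := hdiv _ (F.sub_mem A.2 B.2) hne'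
    have hinj := Matrix.mulVec_injective_iff_isUnit.2 hu
    have h0 : ((A : Matrix ι ι ℚ) - (B : Matrix ι ι ℚ)) *ᵥ v =
        ((A : Matrix ι ι ℚ) - (B : Matrix ι ι ℚ)) *ᵥ 0 := by
      rw [Matrix.mulVec_zero, Matrix.sub_mulVec]
      exact sub_eq_zero.2 hAB
    exact hv (hinj h0)
  have hdim' : finrank ℚ F = finrank ℚ (ι → ℚ) := by rw [hdim, Module.finrank_fintype_fun_eq_card]
  exact ⟨f.linearEquivOfInjective hf hdim', fun A ↦ rfl⟩

/-- Non-degeneracy of the trace pairing on a `†`-stable `F` with `Tr(A†A) > 0`. [folklore] -/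
private theorem eq_zero_of_forall_trace_mul_eq_zero₃ (F : Subalgebra ℚ (Matrix ι ι ℚ))
    {G : Matrix ι ι ℚ} (hFr : ∀ A ∈ F, rosati G A ∈ F)
    (hpos : ∀ A ∈ F, A ≠ 0 → 0 < (rosati G A * A).trace)
    {Y : Matrix ι ι ℚ} (hY : Y ∈ F) (h : ∀ B ∈ F, (Y * B).trace = 0) : Y = 0 := by
  by_contra hY0
  have h1 := hpos Y hY hY0
  rw [Matrix.trace_mul_comm, h _ (hFr Y hY)] at h1
  exact lt_irrefl _ h1

/-- Riesz representation for the trace pairing on `F`. [folklore] -/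
private theorem exists_eq_trace_mul₃ (F : Subalgebra ℚ (Matrix ι ι ℚ)) {G : Matrix ι ι ℚ}
    (hFr : ∀ A ∈ F, rosati G A ∈ F) (hpos : ∀ A ∈ F, A ≠ 0 → 0 < (rosati G A * A).trace)
    (φ : Module.Dual ℚ F) : ∃ ξ : F, ∀ B : F, φ B = ((ξ : Matrix ι ι ℚ) * B).trace := by
  let Ψ : F →ₗ[ℚ] Module.Dual ℚ F := LinearMap.mk₂ ℚ
    (fun Y B ↦ ((Y : Matrix ι ι ℚ) * B).trace)
    (fun Y Y' B ↦ by simp only [Subalgebra.coe_add, Matrix.add_mul, Matrix.trace_add])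
    (fun c Y B ↦ by simp only [Subalgebra.coe_smul, Matrix.smul_mul, Matrix.trace_smul, smul_eq_mul])
    (fun Y B B' ↦ by simp only [Subalgebra.coe_add, Matrix.mul_add, Matrix.trace_add])
    (fun c Y B ↦ by simp only [Subalgebra.coe_smul, Matrix.mul_smul, Matrix.trace_smul, smul_eq_mul])
  have hΨ : Function.Injective Ψ := by
    intro Y Y' hYY'
    have h0 : ∀ B ∈ F, (((Y : Matrix ι ι ℚ) - Y') * B).trace = 0 := by
      intro B hB
      have := congrArg (fun ψ : Module.Dual ℚ F ↦ ψ ⟨B, hB⟩) hYY'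
      simp only [Ψ, LinearMap.mk₂_apply] at this
      rw [Matrix.sub_mul, Matrix.trace_sub, this, sub_self]
    exact Subtype.ext (sub_eq_zero.1
      (eq_zero_of_forall_trace_mul_eq_zero₃ F hFr hpos (F.sub_mem Y.2 Y'.2) h0))
  have hsurj : Function.Surjective Ψ :=
    (LinearMap.injective_iff_surjective_of_finrank_eq_finrank (Subspace.dual_finrank_eq).symm).1 hΨ
  obtain ⟨ξ, hξ⟩ := hsurj φ
  exact ⟨ξ, fun B ↦ by rw [← hξ]; rfl⟩

omit [DecidableEq ι] in
/-- The alternating form `(x, y) ↦ ᵗx G y` is skew. [folklore] -/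
private theorem dotProduct_mulVec_skew₃ {G : Matrix ι ι ℚ} (hGt : Gᵀ = -G) (x y : ι → ℚ) :
    y ⬝ᵥ G *ᵥ x = -(x ⬝ᵥ G *ᵥ y) := by
  rw [Matrix.dotProduct_mulVec, dotProduct_comm, ← Matrix.mulVec_transpose, hGt, Matrix.neg_mulVec,
    dotProduct_neg]

/-- **A `†`-stable skew field `F ⊆ M_ι(ℚ)` of dimension `|ι|` carrying the polarisation has a non-zero
`†`-skew element.**  (`F` a `ℚ`-subalgebra all of whose non-zero elements are invertible, `dim_ℚ F = |ι|`;
`G` invertible alternating with `† = rosati G` preserving `F` and positive on it, `Tr(A†A) > 0`.)  In the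
rank-one model `ℚ^ι = F·v` the form `ᵗx G y` reads `(Av, Bv) ↦ Tr(ξ A†B)` for a unique `ξ ∈ F`; skewness of
the form gives `ξ† = -ξ`, non-degeneracy `ξ ≠ 0`.  In particular `†` is not the identity on `F`: no totally
real field of degree `2 dim X` is `End_ℚ` of a polarised torus with `End_ℚ ⊗ 1`-structure of rank one (the
type-I restriction `e ∣ g` at `m = 1`).  Steps (a)–(d) of the rank-one model of
`ComplexTorusAlbertTypeIIIShimura` / `ComplexTorusDefiniteQuaternionMultiplicationSquare`, WITHOUT the
hypothesis "`A + A†` central" used there from step (e) on.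
[cite: Lange2023AbelianVarietiesComplex, §2.4.1 Thm. 2.4.9 (positivity of `Tr(f'f)`) and §2.6.1 table (type I: `e ∣ g`), PDF p0114, p0138]
[cite: HulekLaface2019PicardNumbersAV, §5.1 (the divisibility conditions (I)–(IV)) (arXiv p. 10)] -/
theorem exists_skew_ne_zero_of_finrank_eq_card [Nonempty ι] (F : Subalgebra ℚ (Matrix ι ι ℚ))
    {G : Matrix ι ι ℚ} (hGu : IsUnit G.det) (hGt : Gᵀ = -G) (hFr : ∀ A ∈ F, rosati G A ∈ F)
    (hdiv : ∀ A ∈ F, A ≠ 0 → IsUnit A) (hpos : ∀ A ∈ F, A ≠ 0 → 0 < (rosati G A * A).trace)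
    (hdim : finrank ℚ F = Fintype.card ι) :
    ∃ ξ ∈ F, ξ ≠ 0 ∧ rosati G ξ = -ξ := by
  classical
  obtain ⟨i₀⟩ := ‹Nonempty ι›
  set v : ι → ℚ := Pi.single i₀ (1 : ℚ) with hv_def
  have hv : v ≠ 0 := by
    intro h
    have h1 := congrFun h i₀
    rw [hv_def, Pi.single_eq_same, Pi.zero_apply] at h1
    exact one_ne_zero h1
  obtain ⟨θ, hθ⟩ := exists_linearEquiv_mulVec₃ F hdiv hdim hv
  have hθmul : ∀ (B : Matrix ι ι ℚ) (hB : B ∈ F) (A : F), B *ᵥ θ A = θ (⟨B, hB⟩ * A) := by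
    intro B hB A
    rw [hθ, hθ, Matrix.mulVec_mulVec]
    rfl
  let φ : Module.Dual ℚ F :=
    { toFun := fun B ↦ v ⬝ᵥ G *ᵥ θ B
      map_add' := fun A B ↦ by simp only [map_add, Matrix.mulVec_add, dotProduct_add]
      map_smul' := fun c A ↦ by
        simp only [map_smul, Matrix.mulVec_smul, dotProduct_smul, smul_eq_mul, RingHom.id_apply] }
  obtain ⟨ξ, hξ⟩ := exists_eq_trace_mul₃ F hFr hpos φ
  have hform : ∀ A B : F,
      θ A ⬝ᵥ G *ᵥ θ B = ((ξ : Matrix ι ι ℚ) * (rosati G A * B)).trace := by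
    intro A B
    have h1 : θ A ⬝ᵥ G *ᵥ θ B = φ (⟨rosati G A, hFr _ A.2⟩ * B) := by
      change _ = v ⬝ᵥ G *ᵥ θ (⟨rosati G A, hFr _ A.2⟩ * B)
      rw [← hθmul (rosati G (A : Matrix ι ι ℚ)) (hFr _ A.2) B, hθ A]
      exact dotProduct_mulVec_rosati hGu _ _ _
    rw [h1, hξ]
    rfl
  have hξskew : rosati G (ξ : Matrix ι ι ℚ) = -(ξ : Matrix ι ι ℚ) := by
    have key : ∀ B : F, ((ξ : Matrix ι ι ℚ) * rosati G B).trace = -((ξ : Matrix ι ι ℚ) * B).trace := by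
      intro B
      have h1 := hform B 1
      have h2 := hform 1 B
      rw [Subalgebra.coe_one, Matrix.mul_one] at h1
      rw [Subalgebra.coe_one, rosati_one hGu, Matrix.one_mul] at h2
      rw [← h1, ← h2]
      exact dotProduct_mulVec_skew₃ hGt _ _
    have h0 : ∀ B ∈ F, (((ξ : Matrix ι ι ℚ) + rosati G ξ) * B).trace = 0 := by
      intro B hB
      have h3 : ((ξ : Matrix ι ι ℚ) * rosati G B).trace = (rosati G (ξ : Matrix ι ι ℚ) * B).trace := by
        rw [← trace_rosati hGu ((ξ : Matrix ι ι ℚ) * rosati G B), rosati_mul hGu, rosati_rosati hGu hGt,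
          Matrix.trace_mul_comm]
      rw [Matrix.add_mul, Matrix.trace_add, ← h3, key ⟨B, hB⟩]
      exact add_neg_cancel _
    have := eq_zero_of_forall_trace_mul_eq_zero₃ F hFr hpos (F.add_mem ξ.2 (hFr _ ξ.2)) h0
    exact eq_neg_of_add_eq_zero_right this
  have hξ0 : (ξ : Matrix ι ι ℚ) ≠ 0 := by
    intro h0
    have h1 : φ (θ.symm (G⁻¹ *ᵥ v)) = 0 := by rw [hξ, h0, Matrix.zero_mul, Matrix.trace_zero]
    have h2 : φ (θ.symm (G⁻¹ *ᵥ v)) = v ⬝ᵥ v := by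
      change v ⬝ᵥ G *ᵥ θ (θ.symm (G⁻¹ *ᵥ v)) = _
      rw [LinearEquiv.apply_symm_apply, Matrix.mulVec_mulVec, Matrix.mul_nonsing_inv _ hGu,
        Matrix.one_mulVec]
    exact hv (dotProduct_self_eq_zero.1 (h2.symm.trans h1))
  exact ⟨ξ, ξ.2, hξ0, hξskew⟩

end RankOne

/-! ## §2 The count: `4 · dim_ℚ F^s ≤ 3 · dim_ℚ F` for a skew field of dimension `rk Λ` -/

section Count

variable {ι : Type*} [Fintype ι] [DecidableEq ι]

/-- `F = F^s ⊕ F^-`: for a `†`-stable subalgebra, with `F^s = F ∩ ker(† - 1)` and `F^- = F ∩ ker(† + 1)`,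
`F^s ⊔ F^- = F` and `F^s ⊓ F^- = 0`, so `dim F = dim F^s + dim F^-`. [folklore] -/
private theorem finrank_symm_add_finrank_skew (F : Subalgebra ℚ (Matrix ι ι ℚ)) {G : Matrix ι ι ℚ}
    (hGu : IsUnit G.det) (hGt : Gᵀ = -G) (hFr : ∀ A ∈ F, rosati G A ∈ F) :
    finrank ℚ ↥(Subalgebra.toSubmodule F ⊓ LinearMap.ker (rosatiLinear G - LinearMap.id)) +
      finrank ℚ ↥(Subalgebra.toSubmodule F ⊓ LinearMap.ker (rosatiLinear G + LinearMap.id)) =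
      finrank ℚ F := by
  set S := Subalgebra.toSubmodule F ⊓ LinearMap.ker (rosatiLinear G - LinearMap.id) with hS
  set W := Subalgebra.toSubmodule F ⊓ LinearMap.ker (rosatiLinear G + LinearMap.id) with hW
  have memS : ∀ A, A ∈ S ↔ A ∈ F ∧ rosati G A = A := by
    intro A
    rw [hS, Submodule.mem_inf, Subalgebra.mem_toSubmodule, LinearMap.mem_ker, LinearMap.sub_apply,
      rosatiLinear_apply, LinearMap.id_apply, sub_eq_zero]
  have memW : ∀ A, A ∈ W ↔ A ∈ F ∧ rosati G A = -A := by
    intro A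
    rw [hW, Submodule.mem_inf, Subalgebra.mem_toSubmodule, LinearMap.mem_ker, LinearMap.add_apply,
      rosatiLinear_apply, LinearMap.id_apply, add_eq_zero_iff_eq_neg]
  have hinf : S ⊓ W = ⊥ := by
    rw [Submodule.eq_bot_iff]
    intro A hA
    obtain ⟨hAS, hAW⟩ := Submodule.mem_inf.1 hA
    have h1 := ((memS A).1 hAS).2
    have h2 := ((memW A).1 hAW).2
    have h : (2 : ℚ) • A = 0 := by rw [two_smul]; nth_rw 1 [← h1]; rw [h2, neg_add_cancel]
    exact (smul_eq_zero.1 h).resolve_left two_ne_zero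
  have hsup : S ⊔ W = Subalgebra.toSubmodule F := by
    refine le_antisymm (sup_le inf_le_left inf_le_left) fun A hA ↦ ?_
    rw [Subalgebra.mem_toSubmodule] at hA
    rw [Submodule.mem_sup]
    refine ⟨(1 / 2 : ℚ) • (A + rosati G A), ?_, (1 / 2 : ℚ) • (A - rosati G A), ?_, ?_⟩
    · rw [memS]
      exact ⟨F.smul_mem (F.add_mem hA (hFr A hA)) _,
        by rw [rosati_smul, rosati_add, rosati_rosati hGu hGt, add_comm]⟩
    · rw [memW]
      exact ⟨F.smul_mem (F.sub_mem hA (hFr A hA)) _,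
        by rw [rosati_smul, rosati_sub, rosati_rosati hGu hGt, ← smul_neg, neg_sub]⟩
    · rw [← smul_add, add_add_sub_cancel, ← two_smul ℚ, smul_smul]
      norm_num
  have hdim := Submodule.finrank_sup_add_finrank_inf_eq S W
  rw [hinf, finrank_bot, add_zero, hsup, Subalgebra.finrank_toSubmodule] at hdim
  exact hdim.symm

/-- **The count `4 · dim_ℚ F^s ≤ 3 · dim_ℚ F`.**  Let `F ⊆ M_ι(ℚ)` be a `†`-stable `ℚ`-subalgebra which is
a skew field of dimension `|ι|` (`ℚ^ι` a rank-one `F`-module), `† = rosati G` for an invertible alternating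
`G`, and suppose `F` has a non-zero `†`-skew element `ξ` (`exists_skew_ne_zero_of_finrank_eq_card`).  Then the
`†`-symmetric part `F^s = {A ∈ F | A† = A}` satisfies `4 dim F^s ≤ 3 dim F`.  Proof (Albert-free): write
`F = F^s ⊕ F^-`, `dim F^s = s`, `dim F^- = a`.  If `ξ` is central in `F`, `x ↦ ξx` maps `F^s` injectively
into `F^-`, so `s ≤ a`.  Otherwise `ξF^s ⊆ F` has dimension `s` and meets `F^s` in
`ξ · {t ∈ F^s | tξ = -ξt}`, so `s ≤ a + dim{t ∈ F^s | tξ = -ξt}`; right multiplication by `s₀⁻¹` (any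
non-zero such `t = s₀`) embeds `{t ∈ F^s | tξ = -ξt}` into the centraliser `C_F(ξ)`, a PROPER division
subalgebra of `F`, whose dimension divides `|ι| = dim F` (Shimura §5.1 Prop. 2 for `C_F(ξ) ⊆ M_ι(ℚ)`, the
tree's `finrank_dvd_card_of_isUnit_or_eq_zero`), hence is `≤ dim F / 2`; so `s ≤ a + dim F/2`, i.e.
`4s ≤ 3 dim F`.  This is the numerical content «`ρ ≤ n`, `3n/2`, `n/2`, `n` (types I–IV)» of the printed
proof of Hulek–Laface Cor. 2.5 at `m = 1`, obtained WITHOUT the classification into types.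
[cite: HulekLaface2019PicardNumbersAV, §2 Cor. 2.5 and proof ("The divisibility conditions for `ρ` […] imply that `ρ ≤ n, 3n/2, n/2, n`") (arXiv p. 6)]
[cite: Shimura1998, §5.1 Prop. 2, p. 36 (`[ℜ : ℚ] = f²d` with `fd ∣ 2n` for a simple subalgebra of `End_ℚ(A)`)] -/
theorem four_mul_finrank_symm_le [Nonempty ι] (F : Subalgebra ℚ (Matrix ι ι ℚ)) {G : Matrix ι ι ℚ}
    (hGu : IsUnit G.det) (hGt : Gᵀ = -G) (hFr : ∀ A ∈ F, rosati G A ∈ F)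
    (hdiv : ∀ A ∈ F, A ≠ 0 → IsUnit A) (hdim : finrank ℚ F = Fintype.card ι)
    {ξ : Matrix ι ι ℚ} (hξF : ξ ∈ F) (hξ0 : ξ ≠ 0) (hξskew : rosati G ξ = -ξ) :
    4 * finrank ℚ ↥(Subalgebra.toSubmodule F ⊓ LinearMap.ker (rosatiLinear G - LinearMap.id)) ≤
      3 * finrank ℚ F := by
  classical
  set V := Subalgebra.toSubmodule F with hV
  set S := V ⊓ LinearMap.ker (rosatiLinear G - LinearMap.id) with hS
  set W := V ⊓ LinearMap.ker (rosatiLinear G + LinearMap.id) with hW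
  have memS : ∀ A, A ∈ S ↔ A ∈ F ∧ rosati G A = A := by
    intro A
    rw [hS, Submodule.mem_inf, hV, Subalgebra.mem_toSubmodule, LinearMap.mem_ker, LinearMap.sub_apply,
      rosatiLinear_apply, LinearMap.id_apply, sub_eq_zero]
  have memW : ∀ A, A ∈ W ↔ A ∈ F ∧ rosati G A = -A := by
    intro A
    rw [hW, Submodule.mem_inf, hV, Subalgebra.mem_toSubmodule, LinearMap.mem_ker, LinearMap.add_apply,
      rosatiLinear_apply, LinearMap.id_apply, add_eq_zero_iff_eq_neg]
  have hsum : finrank ℚ S + finrank ℚ W = finrank ℚ F := finrank_symm_add_finrank_skew F hGu hGt hFr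
  have hξu : IsUnit ξ.det := (Matrix.isUnit_iff_isUnit_det _).1 (hdiv ξ hξF hξ0)
  have hinjL : Function.Injective (LinearMap.mulLeft ℚ ξ : Matrix ι ι ℚ →ₗ[ℚ] Matrix ι ι ℚ) := by
    intro A B hAB
    simp only [LinearMap.mulLeft_apply] at hAB
    have h := congrArg (fun M ↦ ξ⁻¹ * M) hAB
    simpa only [← Matrix.mul_assoc, Matrix.nonsing_inv_mul _ hξu, Matrix.one_mul] using h
  by_cases hc : ∀ B ∈ F, ξ * B = B * ξ
  · -- `ξ` central: `x ↦ ξ x` maps `F^s` into `F^-` injectively, so `s ≤ a`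
    have hmap : S.map (LinearMap.mulLeft ℚ ξ) ≤ W := by
      rintro B ⟨s, hs, rfl⟩
      obtain ⟨hsF, hssym⟩ := (memS s).1 hs
      rw [memW]
      refine ⟨by simpa only [LinearMap.mulLeft_apply] using F.mul_mem hξF hsF, ?_⟩
      rw [LinearMap.mulLeft_apply, rosati_mul hGu, hξskew, hssym, Matrix.mul_neg, hc s hsF]
    have h1 : finrank ℚ S ≤ finrank ℚ W := by
      rw [(Submodule.equivMapOfInjective _ hinjL S).finrank_eq]
      exact Submodule.finrank_mono hmap
    omega
  · -- `ξ` not central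
    have hnc : ∃ y ∈ F, ξ * y ≠ y * ξ := by
      by_contra h
      exact hc fun B hB ↦ by by_contra hB'; exact h ⟨B, hB, hB'⟩
    obtain ⟨y, hyF, hyξ⟩ := hnc
    -- `P = ξ F^s`, `dim P = s`, `P ≤ V`
    set P := S.map (LinearMap.mulLeft ℚ ξ) with hP
    have hPdim : finrank ℚ P = finrank ℚ S := (Submodule.equivMapOfInjective _ hinjL S).finrank_eq.symm
    have hPV : P ≤ V := by
      rintro B ⟨s, hs, rfl⟩
      rw [hV, Subalgebra.mem_toSubmodule, LinearMap.mulLeft_apply]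
      exact F.mul_mem hξF ((memS s).1 hs).1
    -- Claim 1: `dim P ≤ dim (P ⊓ S) + dim W`
    have hVdim : finrank ℚ V = finrank ℚ S + finrank ℚ W := by
      rw [hV, Subalgebra.finrank_toSubmodule]; exact hsum.symm
    have claim1 : finrank ℚ P ≤ finrank ℚ ↥(P ⊓ S) + finrank ℚ W := by
      have h1 := Submodule.finrank_sup_add_finrank_inf_eq P S
      have h2 : finrank ℚ ↥(P ⊔ S) ≤ finrank ℚ V :=
        Submodule.finrank_mono (sup_le hPV inf_le_left)
      omega
    -- Claim 2: `P ⊓ S ≤ ξ · AntiSym`, `AntiSym = {t ∈ F^s | ξt + tξ = 0}`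
    set T := S ⊓ LinearMap.ker (LinearMap.mulLeft ℚ ξ + LinearMap.mulRight ℚ ξ) with hT
    have memT : ∀ A, A ∈ T ↔ (A ∈ F ∧ rosati G A = A) ∧ ξ * A + A * ξ = 0 := by
      intro A
      rw [hT, Submodule.mem_inf, memS, LinearMap.mem_ker, LinearMap.add_apply, LinearMap.mulLeft_apply,
        LinearMap.mulRight_apply]
    have claim2 : P ⊓ S ≤ T.map (LinearMap.mulLeft ℚ ξ) := by
      intro B hB
      obtain ⟨hBP, hBS⟩ := Submodule.mem_inf.1 hB
      obtain ⟨t, ht, rfl⟩ := Submodule.mem_map.1 hBP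
      obtain ⟨htF, htsym⟩ := (memS t).1 ht
      have hsym : rosati G (ξ * t) = ξ * t := by
        have := ((memS _).1 hBS).2
        simpa only [LinearMap.mulLeft_apply] using this
      rw [rosati_mul hGu, hξskew, htsym, Matrix.mul_neg] at hsym
      refine Submodule.mem_map.2 ⟨t, (memT t).2 ⟨⟨htF, htsym⟩, ?_⟩, rfl⟩
      rw [← hsym, neg_add_cancel]
    have claim2' : finrank ℚ ↥(P ⊓ S) ≤ finrank ℚ T :=
      (Submodule.finrank_mono claim2).trans (Submodule.finrank_map_le _ _)
    -- Claim 3: `dim AntiSym ≤ dim C_F(ξ)`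
    set C : Subalgebra ℚ (Matrix ι ι ℚ) := F ⊓ Subalgebra.centralizer ℚ ({ξ} : Set (Matrix ι ι ℚ)) with hC
    have memC : ∀ A, A ∈ C ↔ A ∈ F ∧ ξ * A = A * ξ := by
      intro A
      rw [hC, Algebra.mem_inf, Subalgebra.mem_centralizer_iff]
      simp only [Set.mem_singleton_iff, forall_eq]
    have claim3 : finrank ℚ T ≤ finrank ℚ C := by
      by_cases hT0 : T = ⊥
      · rw [hT0, finrank_bot]; exact Nat.zero_le _
      · obtain ⟨s₀, hs₀T, hs₀0⟩ := (Submodule.ne_bot_iff T).1 hT0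
        obtain ⟨⟨hs₀F, -⟩, hs₀ξ⟩ := (memT s₀).1 hs₀T
        have hs₀u : IsUnit s₀.det := (Matrix.isUnit_iff_isUnit_det _).1 (hdiv s₀ hs₀F hs₀0)
        have hs₀ξ' : s₀ * ξ = -(ξ * s₀) := eq_neg_of_add_eq_zero_right hs₀ξ
        have hξs₀inv : ξ * s₀⁻¹ = -(s₀⁻¹ * ξ) := mul_nonsing_inv_eq_neg_of_anticommute' hs₀u hs₀ξ'
        have hinjR : Function.Injective (LinearMap.mulRight ℚ s₀⁻¹ : Matrix ι ι ℚ →ₗ[ℚ] Matrix ι ι ℚ) := by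
          intro A B hAB
          simp only [LinearMap.mulRight_apply] at hAB
          have h := congrArg (fun M ↦ M * s₀) hAB
          simpa only [Matrix.mul_assoc, Matrix.nonsing_inv_mul _ hs₀u, Matrix.mul_one] using h
        have hmap : T.map (LinearMap.mulRight ℚ s₀⁻¹) ≤ Subalgebra.toSubmodule C := by
          rintro B ⟨t, ht, rfl⟩
          obtain ⟨⟨htF, -⟩, htξ⟩ := (memT t).1 ht
          rw [Subalgebra.mem_toSubmodule, memC, LinearMap.mulRight_apply]
          refine ⟨F.mul_mem htF (nonsing_inv_mem_subalgebra' F hs₀F hs₀u), ?_⟩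
          have htξ' : ξ * t = -(t * ξ) := eq_neg_of_add_eq_zero_left htξ
          rw [← Matrix.mul_assoc, htξ', Matrix.neg_mul, Matrix.mul_assoc, hξs₀inv, Matrix.mul_neg, neg_neg,
            Matrix.mul_assoc]
        calc finrank ℚ T = finrank ℚ ↥(T.map (LinearMap.mulRight ℚ s₀⁻¹)) :=
              (Submodule.equivMapOfInjective _ hinjR T).finrank_eq
          _ ≤ finrank ℚ ↥(Subalgebra.toSubmodule C) := Submodule.finrank_mono hmap
          _ = finrank ℚ C := Subalgebra.finrank_toSubmodule C
    -- Claim 4: `2 dim C ≤ dim F` (`dim C ∣ |ι| = dim F`, `C ≠ F`)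
    have claim4 : 2 * finrank ℚ C ≤ finrank ℚ F := by
      have hCunits : ∀ a : C, IsUnit a ∨ a = 0 := by
        intro a
        by_cases ha : a = 0
        · exact Or.inr ha
        · left
          obtain ⟨haF, haξ⟩ := (memC a).1 a.2
          have ha0 : (a : Matrix ι ι ℚ) ≠ 0 := fun h ↦ ha (Subtype.ext h)
          have hau : IsUnit (a : Matrix ι ι ℚ).det := (Matrix.isUnit_iff_isUnit_det _).1 (hdiv _ haF ha0)
          have hinvC : (a : Matrix ι ι ℚ)⁻¹ ∈ C :=
            (memC _).2 ⟨nonsing_inv_mem_subalgebra' F haF hau, nonsing_inv_comm_of_comm' hau haξ⟩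
          exact ⟨⟨a, ⟨(a : Matrix ι ι ℚ)⁻¹, hinvC⟩, Subtype.ext (Matrix.mul_nonsing_inv _ hau),
            Subtype.ext (Matrix.nonsing_inv_mul _ hau)⟩, rfl⟩
      have hdvd : finrank ℚ C ∣ Fintype.card ι := finrank_dvd_card_of_isUnit_or_eq_zero C hCunits
      have hlt : finrank ℚ C < finrank ℚ F := by
        rw [← Subalgebra.finrank_toSubmodule, ← Subalgebra.finrank_toSubmodule]
        refine Submodule.finrank_lt_finrank_of_lt (lt_of_le_of_ne ?_ ?_)
        · exact Subalgebra.toSubmodule.monotone inf_le_left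
        · intro h
          have hy : y ∈ Subalgebra.toSubmodule C := by rw [h, Subalgebra.mem_toSubmodule]; exact hyF
          rw [Subalgebra.mem_toSubmodule, memC] at hy
          exact hyξ hy.2
      rw [hdim] at hlt ⊢
      obtain ⟨m, hm⟩ := hdvd
      rcases Nat.lt_or_ge m 2 with hm2 | hm2
      · interval_cases m <;> omega
      · calc 2 * finrank ℚ C ≤ m * finrank ℚ C := Nat.mul_le_mul_right _ hm2
          _ = Fintype.card ι := by rw [hm, mul_comm]
    omega

end Count

/-! ## §3 `ρ(X) ≤ 3/2 · dim X` and Hulek–Laface Cor. 2.5 for a simple polarised torus -/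

section Torus

variable {ι : Type*} [Fintype ι] [DecidableEq ι] [Nonempty ι] {E : Type*} [NormedAddCommGroup E]
  [NormedSpace ℂ E] {Ψ : (ι → ℝ) ≃L[ℝ] E} {η : E [⋀^Fin 2]→L[ℝ] ℝ} {G : Matrix ι ι ℚ}

omit [Nonempty ι] in
/-- `End^s_ℚ(X) = End_ℚ(X) ∩ ker(† - 1)` (the tree's `symmEndRat` as an intersection of submodules).
[cite: Lange2023AbelianVarietiesComplex, §2.4.2 (before Prop. 2.4.12)] -/
theorem symmEndRat_eq_inf (Ψ : (ι → ℝ) ≃L[ℝ] E) (G : Matrix ι ι ℚ) :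
    symmEndRat Ψ G =
      Subalgebra.toSubmodule (endAlgRat Ψ) ⊓ LinearMap.ker (rosatiLinear G - LinearMap.id) := by
  ext A
  rw [mem_symmEndRat_iff, Submodule.mem_inf, Subalgebra.mem_toSubmodule, LinearMap.mem_ker,
    LinearMap.sub_apply, rosatiLinear_apply, LinearMap.id_apply, sub_eq_zero]

/-- **`4 · dim_ℚ End^s_ℚ(X) ≤ 3 · dim_ℚ End_ℚ(X)` for a simple polarised torus with `dim_ℚ End_ℚ(X) = rk Λ`**
(the case `m = 1` of the printed bound «`ρ ≤ n, 3n/2, n/2, n`»: `ρ(X) = dim End^s_ℚ(X) ≤ ¾ · 2 dim X`),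
from §1–§2 with `F = End_ℚ(X)`, `† =` the Rosati involution (positive, Thm. 2.4.9 / the tree's
`trace_rosati_mul_self_pos_rat`; `End_ℚ(X)` a skew field, Cor. 2.4.26).
[cite: HulekLaface2019PicardNumbersAV, §2 Cor. 2.5, proof (arXiv p. 6)]
[cite: Lange2023AbelianVarietiesComplex, §2.4.2 Prop. 2.4.12 and §2.6.1 table, column `ρ`] -/
theorem IsSimple.four_mul_finrank_symmEndRat_le (hX : IsSimple Ψ) (hη : IsRiemannForm Ψ η)
    (hG : G.map (Rat.cast : ℚ → ℝ) = latticeGram Ψ η) (hdim : finrank ℚ (endAlgRat Ψ) = Fintype.card ι) :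
    4 * finrank ℚ (symmEndRat Ψ G) ≤ 3 * finrank ℚ (endAlgRat Ψ) := by
  have hGu : IsUnit G.det := isUnit_det_of_map_ratCast hG hη.isUnit_det_latticeGram
  have hGt : Gᵀ = -G := transpose_eq_neg_of_map_ratCast Ψ hG
  have hFr : ∀ A ∈ endAlgRat Ψ, rosati G A ∈ endAlgRat Ψ :=
    fun A hA ↦ rosati_mem_endAlgRat Ψ hη.1 hη.2.2 hG hA
  have hdiv : ∀ A ∈ endAlgRat Ψ, A ≠ 0 → IsUnit A := fun A hA hA0 ↦ hX.isUnit_of_mem_endAlgRat hA hA0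
  have hpos : ∀ A ∈ endAlgRat Ψ, A ≠ 0 → 0 < (rosati G A * A).trace :=
    fun A hA hA0 ↦ trace_rosati_mul_self_pos_rat Ψ hη.1 hη.2.2 hG hA hA0
  obtain ⟨ξ, hξF, hξ0, hξskew⟩ :=
    exists_skew_ne_zero_of_finrank_eq_card (endAlgRat Ψ) hGu hGt hFr hdiv hpos hdim
  rw [symmEndRat_eq_inf]
  exact four_mul_finrank_symm_le (endAlgRat Ψ) hGu hGt hFr hdiv hdim hξF hξ0 hξskew

/-- **`ρ(X) ≤ 3/2 · dim X` for a SIMPLE polarised complex torus** (= a simple abelian variety; Hulek–Laface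
Cor. 2.5 at `k = 1`, i.e. the maximum `3n/2` of the printed type-by-type bounds «`ρ ≤ n` (I), `3n/2` (II),
`n/2` (III), `n` (IV)»), proved WITHOUT Albert's classification: with `f = dim_ℚ End_ℚ(X) ∣ 2 dim X`
(Shimura's Prop. 2, the tree's `IsSimple.finrank_endAlgRat_dvd_card`) and `ρ(X) = dim End^s_ℚ(X)`
(Prop. 2.4.12), either `f ≤ dim X` and `ρ ≤ f`, or `f = 2 dim X` and `4ρ ≤ 3f`
(`IsSimple.four_mul_finrank_symmEndRat_le`).  Stated as `2ρ(X) ≤ 3 dim X`.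
[cite: HulekLaface2019PicardNumbersAV, §2 Cor. 2.5 (`k = 1`) (arXiv p. 6)] -/
theorem IsSimple.two_mul_finrank_neronSeveriGroup_le_three_mul [FiniteDimensional ℂ E] (hX : IsSimple Ψ)
    (hη : IsRiemannForm Ψ η) : 2 * finrank ℤ (neronSeveriGroup Ψ) ≤ 3 * finrank ℂ E := by
  obtain ⟨G, hG, hdet⟩ := hη.exists_ratMatrix_latticeGram_isUnit
  have hρ : finrank ℤ (neronSeveriGroup Ψ) = finrank ℚ (symmEndRat Ψ G) := by
    rw [finrank_neronSeveriGroup_eq_finrank_hodgeClasses,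
      finrank_hodgeClasses_one_eq_finrank_symmEndRat hη.1 hG hdet]
  have hcard : Fintype.card ι = 2 * finrank ℂ E := card_eq_two_mul_finrank Ψ
  have hdvd : finrank ℚ (endAlgRat Ψ) ∣ Fintype.card ι := hX.finrank_endAlgRat_dvd_card
  have hρle : finrank ℚ (symmEndRat Ψ G) ≤ finrank ℚ (endAlgRat Ψ) := by
    rw [← Subalgebra.finrank_toSubmodule]
    exact Submodule.finrank_mono fun A hA ↦ ((mem_symmEndRat_iff Ψ).1 hA).1
  by_cases hdim : finrank ℚ (endAlgRat Ψ) = Fintype.card ι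
  · have h4 := hX.four_mul_finrank_symmEndRat_le hη hG hdim
    omega
  · obtain ⟨m, hm⟩ := hdvd
    have hm2 : 2 ≤ m := by
      by_contra hlt
      interval_cases m
      · exact (Fintype.card_ne_zero (hm.trans (mul_zero _)))
      · exact hdim (by rw [hm, mul_one])
    have h2 : 2 * finrank ℚ (endAlgRat Ψ) ≤ Fintype.card ι := by
      calc 2 * finrank ℚ (endAlgRat Ψ) ≤ m * finrank ℚ (endAlgRat Ψ) := Nat.mul_le_mul_right _ hm2
        _ = Fintype.card ι := by rw [hm, mul_comm]
    omega

/-- `ρ(X) ≤ 3/2 · dim X` for a simple complex torus which is an abelian variety (polarisation-free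
form of `IsSimple.two_mul_finrank_neronSeveriGroup_le_three_mul`).
[cite: HulekLaface2019PicardNumbersAV, §2 Cor. 2.5 (`k = 1`) (arXiv p. 6)] -/
theorem IsSimple.two_mul_finrank_neronSeveriGroup_le_three_mul_of_isAbelianVariety [FiniteDimensional ℂ E]
    (hX : IsSimple Ψ) (hA : IsAbelianVariety Ψ) : 2 * finrank ℤ (neronSeveriGroup Ψ) ≤ 3 * finrank ℂ E := by
  obtain ⟨η, hη⟩ := hA
  exact hX.two_mul_finrank_neronSeveriGroup_le_three_mul hη

/-- **Hulek–Laface 2019 Cor. 2.5 (Murty's bound), as printed and unconditionally**: «Let `A` be a simple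
abelian variety of dimension `n`, and let `k ≥ 1`. Then `ρ(Aᵏ) ≤ ½ n k (2k+1)`.»  Here for a simple
complex torus `X = E/Ψ(ℤ^ι)` which is an abelian variety, `n = dim_ℂ E`, `Xᵏ = powPeriod Ψ k`, stated as
`2 ρ(Xᵏ) ≤ n k (2k+1)` (all `k`; `k = 0` is trivial).  Proof: `ρ(Xᵏ) = k ρ(X) + C(k,2) dim_ℚ End_ℚ(X)`
(p18's type-free `IsAbelianVariety.finrank_neronSeveriGroup_pow`), `2ρ(X) ≤ 3n`
(`IsSimple.two_mul_finrank_neronSeveriGroup_le_three_mul`) and `dim_ℚ End_ℚ(X) ≤ 2n`, so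
`2ρ(Xᵏ) ≤ 3nk + 2n k(k-1) = nk(2k+1)`.  The printed proof goes through Prop. 2.4 (Murty 1984, Lemma 3.3)
and the Albert types; this one does not.
[cite: HulekLaface2019PicardNumbersAV, §2 Cor. 2.5 (arXiv p. 6)]
[cite: Murty1984, Lemma 3.3] -/
theorem IsSimple.two_mul_finrank_neronSeveriGroup_pow_le [FiniteDimensional ℂ E] (hX : IsSimple Ψ)
    (hA : IsAbelianVariety Ψ) (k : ℕ) :
    2 * finrank ℤ (neronSeveriGroup (powPeriod Ψ k)) ≤ finrank ℂ E * k * (2 * k + 1) := by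
  rw [hA.finrank_neronSeveriGroup_pow k]
  have h1 := hX.two_mul_finrank_neronSeveriGroup_le_three_mul_of_isAbelianVariety hA
  have h2 : finrank ℚ (endAlgRat Ψ) ≤ 2 * finrank ℂ E := by
    rw [← card_eq_two_mul_finrank Ψ]; exact hX.finrank_endAlgRat_le_card
  have hc : 2 * k.choose 2 = k * (k - 1) := by
    rw [Nat.choose_two_right, Nat.two_mul_div_two_of_even (Nat.even_mul_pred_self k)]
  set ρ := finrank ℤ (neronSeveriGroup Ψ)
  set f := finrank ℚ (endAlgRat Ψ)
  set n := finrank ℂ E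
  rcases Nat.eq_zero_or_pos k with rfl | hk
  · simp
  · obtain ⟨j, rfl⟩ : ∃ j, k = j + 1 := ⟨k - 1, (Nat.sub_add_cancel hk).symm⟩
    rw [Nat.add_sub_cancel] at hc
    have e1 : 2 * ((j + 1) * ρ) ≤ 3 * n * (j + 1) := by nlinarith
    have e2 : 2 * ((j + 1).choose 2 * f) ≤ (j + 1) * j * (2 * n) := by
      rw [← mul_assoc, hc]; exact Nat.mul_le_mul_left _ h2
    have e3 : n * (j + 1) * (2 * (j + 1) + 1) = 3 * n * (j + 1) + (j + 1) * j * (2 * n) := by ring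
    rw [mul_add, e3]
    exact add_le_add e1 e2

end Torus

/-! ## §4 Printed shapes: `ρ ≤ 3n/2`, `ρ(Aᵏ) ≤ ½nk(2k+1)` with integer division, and along `A ∼ Bᵏ` -/

section Shapes

variable {ι : Type*} [Fintype ι] [DecidableEq ι] [Nonempty ι] {E : Type*} [NormedAddCommGroup E]
  [NormedSpace ℂ E] {Ψ : (ι → ℝ) ≃L[ℝ] E}

/-- **Cor. 2.5 in the printed shape `ρ(Aᵏ) ≤ ½ n k (2k+1)`** (natural-number division; the interface of
the per-type `IsSimple.finrank_neronSeveriGroup_pow_le_of_isAlbertTypeI … IV` of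
`ComplexTorusPicardNumberAlbertTypes`, here without any Albert-type hypothesis).
[cite: HulekLaface2019PicardNumbersAV, §2 Cor. 2.5 (arXiv p. 6)] -/
theorem IsSimple.finrank_neronSeveriGroup_pow_le_div_two [FiniteDimensional ℂ E] (hX : IsSimple Ψ)
    (hA : IsAbelianVariety Ψ) (k : ℕ) :
    finrank ℤ (neronSeveriGroup (powPeriod Ψ k)) ≤ finrank ℂ E * k * (2 * k + 1) / 2 := by
  rw [Nat.le_div_iff_mul_le zero_lt_two]
  have h := hX.two_mul_finrank_neronSeveriGroup_pow_le hA k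
  omega

/-- **`ρ(A) ≤ 3n/2` in the printed shape** (natural-number division), for a simple abelian variety `A` of
dimension `n`. [cite: HulekLaface2019PicardNumbersAV, §2 Cor. 2.5 (`k = 1`) and proof, `ρ ≤ 3n/2` (arXiv p. 6)] -/
theorem IsSimple.finrank_neronSeveriGroup_le_three_mul_div_two [FiniteDimensional ℂ E] (hX : IsSimple Ψ)
    (hA : IsAbelianVariety Ψ) : finrank ℤ (neronSeveriGroup Ψ) ≤ 3 * finrank ℂ E / 2 := by
  rw [Nat.le_div_iff_mul_le zero_lt_two]
  have h := hX.two_mul_finrank_neronSeveriGroup_le_three_mul_of_isAbelianVariety hA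
  omega

variable {ι' : Type*} [Fintype ι'] [DecidableEq ι'] {E' : Type*} [NormedAddCommGroup E'] [NormedSpace ℂ E']

/-- **Cor. 2.5 along an isogeny `A ∼ Bᵏ`** — the use made of it in §3.2 (b) and §3.3 of the paper («Let
`B` be an `m`-dimensional simple abelian variety, and suppose `A` is isogenous to `Bᵏ` […] by Corollary 2.5
we have `ρ(Bᵏ) ≤ ½ g(2k+1)`», `g = mk = dim A`): `2ρ(A) ≤ m k (2k+1)`, `m = dim B`, by the isogeny
invariance of `ρ` (`IsIsogenous.finrank_neronSeveriGroup_eq`).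
[cite: HulekLaface2019PicardNumbersAV, §2 Cor. 2.5 and §3.2 (b) (arXiv pp. 6–8)] -/
theorem IsIsogenous.two_mul_finrank_neronSeveriGroup_le_of_powPeriod [FiniteDimensional ℂ E]
    {A : (ι' → ℝ) ≃L[ℝ] E'} {k : ℕ} (hiso : IsIsogenous A (powPeriod Ψ k)) (hX : IsSimple Ψ)
    (hB : IsAbelianVariety Ψ) :
    2 * finrank ℤ (neronSeveriGroup A) ≤ finrank ℂ E * k * (2 * k + 1) := by
  rw [hiso.finrank_neronSeveriGroup_eq]
  exact hX.two_mul_finrank_neronSeveriGroup_pow_le hB k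

end Shapes

/-! ## §5 The divisibility conditions (I)–(IV) of Hulek–Laface §5.1 on `ρ(X)`, type by type (as printed) -/

section Divisibility

open NumberField Literature.RingTheory.CentralSimple
open Literature.NumberTheory.Automorphic (IsQuaternionAlgebra)

variable {κ : Type} [Fintype κ] [DecidableEq κ] [Nonempty κ] {E : Type*} [NormedAddCommGroup E]
  [NormedSpace ℂ E] [FiniteDimensional ℂ E] {Ψ : (κ → ℝ) ≃L[ℝ] E} {η : E [⋀^Fin 2]→L[ℝ] ℝ}
  {G : Matrix κ κ ℚ}

omit [FiniteDimensional ℂ E] in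
/-- `ℚ ⊆ K ⊆ End_ℚ(X)` is a scalar tower. [folklore] -/
private theorem centerField.isScalarTower_rat' (hX : IsSimple Ψ) :
    IsScalarTower ℚ (centerField Ψ hX) (endAlgRat Ψ) :=
  IsScalarTower.of_algebraMap_smul fun q x ↦ by
    rw [Algebra.smul_def, Algebra.algebraMap_eq_smul_one q,
      map_rat_smul (algebraMap (centerField Ψ hX) (endAlgRat Ψ)) q 1, map_one, smul_mul_assoc, one_mul]

/-- **(I) Type I: `ρ ∣ g`** («If `X` is a simple abelian variety of dimension `g`, its Picard number
`ρ = ρ(X)` must respect some divisibility conditions [BL04], namely (I) Type I: `ρ ∣ g`»; `ρ = e` and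
`e ∣ g`, the tree's `IsSimple.finrank_neronSeveriGroup_of_isAlbertTypeI` and
`IsSimple.finrank_centerField_dvd_of_isTotallyReal`).
[cite: HulekLaface2019PicardNumbersAV, §5.1 condition (I) (arXiv p. 10)]
[cite: Lange2023AbelianVarietiesComplex, §2.6.1 Proposition, table line 1 (`ρ = e`, `e ∣ g`)] -/
theorem IsSimple.finrank_neronSeveriGroup_dvd_of_isAlbertTypeI (hX : IsSimple Ψ) (hη : IsRiemannForm Ψ η)
    (hG : G.map (Rat.cast : ℚ → ℝ) = latticeGram Ψ η)
    (h : IsAlbertTypeI (centerField Ψ hX) (endAlgRat Ψ) (rosatiEnd Ψ hη.1 hη.2.2 hG)) :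
    finrank ℤ (neronSeveriGroup Ψ) ∣ finrank ℂ E := by
  haveI := h.isTotallyReal
  rw [hX.finrank_neronSeveriGroup_of_isAlbertTypeI hη hG h]
  exact hX.finrank_centerField_dvd_of_isTotallyReal

/-- **`2e ∣ g` when `End_ℚ(X)` is a quaternion algebra over its centre** (`[End_ℚ(X) : ℚ] = 4e ∣ 2g`;
the "restriction" `2e ∣ g` of lines 2–3 of Lange's table, as a divisibility — the tree's
`IsSimple.two_mul_finrank_centerField_le` is the inequality).
[cite: Lange2023AbelianVarietiesComplex, §2.6.1 Proposition, table lines 2–3 (`2e ∣ g`) and proof p0139 L1–L3] -/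
theorem IsSimple.two_mul_finrank_centerField_dvd (hX : IsSimple Ψ)
    [IsQuaternionAlgebra (centerField Ψ hX) (endAlgRat Ψ)] :
    2 * finrank ℚ (centerField Ψ hX) ∣ finrank ℂ E := by
  haveI := centerField.isScalarTower_rat' hX
  have h4 := IsQuaternionAlgebra.finrank_eq_four (K := centerField Ψ hX) (D := endAlgRat Ψ)
  have hd := hX.finrank_endAlgRat_dvd_two_mul_finrank
  rw [← Module.finrank_mul_finrank ℚ (centerField Ψ hX) (endAlgRat Ψ), h4,
    show finrank ℚ (centerField Ψ hX) * 4 = 2 * (2 * finrank ℚ (centerField Ψ hX)) by ring] at hd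
  exact Nat.dvd_of_mul_dvd_mul_left zero_lt_two hd

/-- **(II) Type II: `ρ ∈ 3ℕ` and `⅔ρ ∣ g`** (`ρ = 3e`, `2e ∣ g`).
[cite: HulekLaface2019PicardNumbersAV, §5.1 condition (II) (arXiv p. 10)]
[cite: Lange2023AbelianVarietiesComplex, §2.6.1 Proposition, table line 2 (`ρ = 3e`, `2e ∣ g`)] -/
theorem IsSimple.finrank_neronSeveriGroup_dvd_of_isAlbertTypeII (hX : IsSimple Ψ) (hη : IsRiemannForm Ψ η)
    (hG : G.map (Rat.cast : ℚ → ℝ) = latticeGram Ψ η)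
    (h : IsAlbertTypeII (centerField Ψ hX) (endAlgRat Ψ) (rosatiEnd Ψ hη.1 hη.2.2 hG)) :
    3 ∣ finrank ℤ (neronSeveriGroup Ψ) ∧ 2 * (finrank ℤ (neronSeveriGroup Ψ) / 3) ∣ finrank ℂ E := by
  haveI := h.isQuaternionAlgebra
  rw [hX.finrank_neronSeveriGroup_of_isAlbertTypeII hη hG h, Nat.mul_div_cancel_left _ zero_lt_three]
  exact ⟨dvd_mul_right 3 _, hX.two_mul_finrank_centerField_dvd⟩

/-- **(III) Type III: `2ρ ∣ g`** (`ρ = e`, `2e ∣ g`).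
[cite: HulekLaface2019PicardNumbersAV, §5.1 condition (III) (arXiv p. 10)]
[cite: Lange2023AbelianVarietiesComplex, §2.6.1 Proposition, table line 3 (`ρ = e`, `2e ∣ g`)] -/
theorem IsSimple.two_mul_finrank_neronSeveriGroup_dvd_of_isAlbertTypeIII (hX : IsSimple Ψ)
    (hη : IsRiemannForm Ψ η) (hG : G.map (Rat.cast : ℚ → ℝ) = latticeGram Ψ η)
    (h : IsAlbertTypeIII (centerField Ψ hX) (endAlgRat Ψ) (rosatiEnd Ψ hη.1 hη.2.2 hG)) :
    2 * finrank ℤ (neronSeveriGroup Ψ) ∣ finrank ℂ E := by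
  haveI := h.isQuaternionAlgebra
  rw [hX.finrank_neronSeveriGroup_of_isAlbertTypeIII hη hG h]
  exact hX.two_mul_finrank_centerField_dvd

/-- **(IV) for a CM centre: `ρ ∣ g`** (`2ρ = [End_ℚ(X) : ℚ] ∣ 2g`, i.e. `ρ = e₀d² ∣ g`; hypothesis-light
form through the tree's `IsSimple.two_mul_finrank_neronSeveriGroup_of_isCMField`).
[cite: HulekLaface2019PicardNumbersAV, §5.1 condition (IV) (arXiv p. 10)]
[cite: Lange2023AbelianVarietiesComplex, §2.6.1 Proposition, table line 4 (`ρ = e₀d²`, `e₀d² ∣ g`)] -/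
theorem IsSimple.finrank_neronSeveriGroup_dvd_of_isCMField (hX : IsSimple Ψ) (hη : IsRiemannForm Ψ η)
    [IsCMField (centerField Ψ hX)] : finrank ℤ (neronSeveriGroup Ψ) ∣ finrank ℂ E := by
  have h2 := hX.two_mul_finrank_neronSeveriGroup_of_isCMField hη
  have hd := hX.finrank_endAlgRat_dvd_two_mul_finrank
  rw [← h2] at hd
  exact Nat.dvd_of_mul_dvd_mul_left zero_lt_two hd

/-- **(IV) Type IV: `ρ ∣ g`.**
[cite: HulekLaface2019PicardNumbersAV, §5.1 condition (IV) (arXiv p. 10)]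
[cite: Lange2023AbelianVarietiesComplex, §2.6.1 Proposition, table line 4 (`e₀d² ∣ g`)] -/
theorem IsSimple.finrank_neronSeveriGroup_dvd_of_isAlbertTypeIV (hX : IsSimple Ψ) (hη : IsRiemannForm Ψ η)
    (hG : G.map (Rat.cast : ℚ → ℝ) = latticeGram Ψ η)
    (h : IsAlbertTypeIV (centerField Ψ hX) (endAlgRat Ψ) (rosatiEnd Ψ hη.1 hη.2.2 hG)) :
    finrank ℤ (neronSeveriGroup Ψ) ∣ finrank ℂ E := by
  haveI := centerField.isScalarTower_rat' hX
  haveI := h.isCMField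
  exact hX.finrank_neronSeveriGroup_dvd_of_isCMField hη

/-- **(I)–(IV) together for `g ≤ 7`, unconditionally**: by Albert's theorem in dimension `≤ 7` (the tree's
`IsSimple.isAlbertType_of_finrank_le_seven`, Step I by counting), the Picard number `ρ` of a simple
polarised complex torus of dimension `g ≤ 7` satisfies `ρ ∣ g` (types I, IV), or `3 ∣ ρ` and `⅔ρ ∣ g`
(type II), or `2ρ ∣ g` (type III).
[cite: HulekLaface2019PicardNumbersAV, §5.1 conditions (I)–(IV) (arXiv p. 10)]
[cite: Lange2023AbelianVarietiesComplex, §2.6.1 Proposition, column "restriction"] -/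
theorem IsSimple.finrank_neronSeveriGroup_dvd_or_of_finrank_le_seven (hX : IsSimple Ψ)
    (hη : IsRiemannForm Ψ η) (hg : finrank ℂ E ≤ 7) :
    finrank ℤ (neronSeveriGroup Ψ) ∣ finrank ℂ E ∨
      (3 ∣ finrank ℤ (neronSeveriGroup Ψ) ∧ 2 * (finrank ℤ (neronSeveriGroup Ψ) / 3) ∣ finrank ℂ E) ∨
      2 * finrank ℤ (neronSeveriGroup Ψ) ∣ finrank ℂ E := by
  obtain ⟨G, hG⟩ := hη.exists_ratMatrix_latticeGram
  rcases hX.isAlbertType_of_finrank_le_seven hη hG hg with h | h | h | h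
  · exact Or.inl (hX.finrank_neronSeveriGroup_dvd_of_isAlbertTypeI hη hG h)
  · exact Or.inr (Or.inl (hX.finrank_neronSeveriGroup_dvd_of_isAlbertTypeII hη hG h))
  · exact Or.inr (Or.inr (hX.two_mul_finrank_neronSeveriGroup_dvd_of_isAlbertTypeIII hη hG h))
  · exact Or.inl (hX.finrank_neronSeveriGroup_dvd_of_isAlbertTypeIV hη hG h)

end Divisibility


end ComplexTorus

end Literature.Geometry.Kaehler
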